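import Literature.Computability.Cryptography.HallgrenClassGroup

/-!
# Stub `stub_oneSidedNagell` of line `Sketch` (skeleton v4, Nagell planting) for the crux
`ArithStatLadder.IqThreeNotPPoly`

Exact one-sidedness (the NO side) of the planted Nagell family. On the `6`-free core `G` of the
modulus and seed `j` the sampler outputs `d = u (u + 8) (4u + 27)` with `u = G t`,
`t = 1 + 11G + 11G² + 30Gj`. If `G` has a square prime factor, or is even, or is divisible by `3`,
then `−d` is never a negative fundamental discriminant.

Mathematics.
* `p` an odd prime with `p² ∣ G`: then `p² ∣ G ∣ u ∣ d`, so neither `−d` nor `(−d)/4` is squarefree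
  (`p²` is prime to `4`).
* `2 ∣ G` (this also covers `p = 2`): `u = 2v` is even and `d = 4 · v (v + 4) (8v + 27)`. If `v` is
  even then `16 ∣ d`, so `−d ≡ 0 (mod 4)` and `(−d)/4 ≡ 0 (mod 4)`; if `v` is odd then
  `v (v + 4) ≡ 1 (mod 4)` and `8v + 27 ≡ 3 (mod 4)`, so `d ≡ 12 (mod 16)`, `−d ≡ 0 (mod 4)` and
  `(−d)/4 ≡ 1 (mod 4)`. Either way both branches of `IsNegFundamentalDiscr` fail.
* `3 ∣ G`: `3 ∣ u` and `3 ∣ 4u + 27`, so `9 ∣ d`: the odd-prime case with `p = 3`.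

The divisibility exclusions `16 ∣ d` / `p² ∣ d` (`p` odd) are the same arguments as the helper
theorems `not_isNegFundamentalDiscr_of_sixteen_dvd` /
`not_isNegFundamentalDiscr_of_odd_prime_sq_dvd` of the sibling stub file
`ArithStatLadderIqThreeNotPPolyStubOneSided` (stub `stub_oneSided`); they are re-proved here (as
private helpers) so that this file builds from `HallgrenClassGroup` alone.
-/

set_option linter.dupNamespace false -- D-0017: single-problem summit ⇒ QuantumAdvantage.QuantumAdvantage by design

namespace Summit.QuantumAdvantage.QuantumAdvantage.Theorems.IqThreeNotPPoly

open scoped Classical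
open Literature.Computability.Cryptography (IsNegFundamentalDiscr)

/-- If `16 ∣ d` then `−d` is not a negative fundamental discriminant (both residue conditions
fail: `−d ≡ 0 (mod 4)` and `(−d)/4 ≡ 0 (mod 4)`); this also covers `d = 0`. -/
private theorem nagell_not_isNegFundamentalDiscr_of_sixteen_dvd {d : ℕ} (h : 16 ∣ d) :
    ¬ IsNegFundamentalDiscr d := by
  rintro (⟨h1, -, -⟩ | ⟨-, h2, -⟩) <;> omega

/-- If `d ≡ 12 (mod 16)` then `−d` is not a negative fundamental discriminant: `−d ≡ 0 (mod 4)`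
excludes the first branch and `(−d)/4 ≡ 1 (mod 4)` (neither `2` nor `3`) excludes the second. -/
private theorem nagell_not_isNegFundamentalDiscr_of_mod_sixteen_eq_twelve {d : ℕ}
    (h : d % 16 = 12) : ¬ IsNegFundamentalDiscr d := by
  rintro (⟨h1, -, -⟩ | ⟨-, h2, -⟩) <;> omega

/-- If the square of an odd prime divides `d` then `−d` is not a negative fundamental discriminant
(neither `−d` nor `(−d)/4` is squarefree). -/
private theorem nagell_not_isNegFundamentalDiscr_of_odd_prime_sq_dvd {d p : ℕ} (hp : p.Prime)
    (hp2 : p ≠ 2) (hd : p * p ∣ d) : ¬ IsNegFundamentalDiscr d := by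
  have hpu : ¬ IsUnit p := hp.not_isUnit
  rintro (⟨-, hsq, -⟩ | ⟨h4, -, hsq⟩)
  · rw [← Int.squarefree_natAbs, Int.natAbs_neg, Int.natAbs_natCast] at hsq
    exact hpu (hsq p hd)
  · have h4' : 4 ∣ d := Int.natCast_dvd_natCast.1 (dvd_neg.1 h4)
    obtain ⟨q, rfl⟩ := h4'
    have he : (-((4 * q : ℕ) : ℤ)) / 4 = -(q : ℤ) := by push_cast; omega
    rw [he, ← Int.squarefree_natAbs, Int.natAbs_neg, Int.natAbs_natCast] at hsq
    have hcop : Nat.Coprime (p * p) 4 := by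
      simpa [pow_two] using Nat.coprime_pow_primes 2 2 hp Nat.prime_two hp2
    exact hpu (hsq p (hcop.dvd_of_dvd_mul_left hd))

/-- The even case of the Nagell family: if `u` is even then `−u (u + 8) (4u + 27)` is not a negative
fundamental discriminant. Writing `u = 2v`, `d = 4 · v (v + 4) (8v + 27)`; for `v` even `16 ∣ d`,
for `v` odd `d ≡ 12 (mod 16)`. -/
private theorem nagell_not_isNegFundamentalDiscr_of_two_dvd {u : ℕ} (h : 2 ∣ u) :
    ¬ IsNegFundamentalDiscr (u * (u + 8) * (4 * u + 27)) := by
  obtain ⟨v, rfl⟩ := h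
  obtain ⟨w, rfl | rfl⟩ := Nat.even_or_odd' v
  · -- `u = 4w`: `d = 16 · w (w + 2) (16w + 27)`
    apply nagell_not_isNegFundamentalDiscr_of_sixteen_dvd
    exact ⟨w * (w + 2) * (16 * w + 27), by ring⟩
  · -- `u = 4w + 2`: `d = 16 · (16w³ + 83w² + 125w + 43) + 12`
    apply nagell_not_isNegFundamentalDiscr_of_mod_sixteen_eq_twelve
    have e : 2 * (2 * w + 1) * (2 * (2 * w + 1) + 8) * (4 * (2 * (2 * w + 1)) + 27) =
        16 * (16 * w ^ 3 + 83 * w ^ 2 + 125 * w + 43) + 12 := by ring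
    omega

/-- **STUB B · `stub_oneSidedNagell`** (ONE-SIDEDNESS, exact). For the planted Nagell family
`d = u (u + 8) (4u + 27)`, `u = G t`, `t = 1 + 11G + 11G² + 30Gj`: if the core `G` has a square
prime factor, or is even, or is divisible by `3`, then `−d` is never a negative fundamental
discriminant. Indeed `G ∣ u ∣ d`; an odd prime `p` with `p² ∣ G` gives `p² ∣ d`, so neither `−d`
nor `(−d)/4` is squarefree; `2 ∣ G` (also the case `p = 2`) makes `u` even, whence `16 ∣ d` or
`d ≡ 12 (mod 16)`, and both residue conditions `−d ≡ 1 (mod 4)` / `(−d)/4 ≡ 2, 3 (mod 4)` fail;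
`3 ∣ G` gives `3 ∣ u`, `3 ∣ 4u + 27`, so `9 ∣ d`. -/
theorem stub_oneSidedNagell :
    ∀ (G j : ℕ), ((∃ p : ℕ, p.Prime ∧ p ^ 2 ∣ G) ∨ 2 ∣ G ∨ 3 ∣ G) →
    ¬ IsNegFundamentalDiscr (G * (1 + 11 * G + 11 * G ^ 2 + 30 * G * j) *
      (G * (1 + 11 * G + 11 * G ^ 2 + 30 * G * j) + 8) *
      (4 * (G * (1 + 11 * G + 11 * G ^ 2 + 30 * G * j)) + 27)) := by
  intro G j hG
  have hGu : G ∣ G * (1 + 11 * G + 11 * G ^ 2 + 30 * G * j) := dvd_mul_right G _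
  generalize G * (1 + 11 * G + 11 * G ^ 2 + 30 * G * j) = u at hGu ⊢
  -- `u ∣ d`
  have hud : u ∣ u * (u + 8) * (4 * u + 27) := (dvd_mul_right u _).mul_right _
  rcases hG with ⟨p, hp, hpG⟩ | h2 | h3
  · rcases eq_or_ne p 2 with rfl | hp2
    · -- `4 ∣ G`, so `u` is even
      exact nagell_not_isNegFundamentalDiscr_of_two_dvd
        ((dvd_pow_self 2 two_ne_zero).trans (hpG.trans hGu))
    · -- `p` odd, `p² ∣ G ∣ u ∣ d`
      exact nagell_not_isNegFundamentalDiscr_of_odd_prime_sq_dvd hp hp2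
        ((pow_two p ▸ hpG).trans (hGu.trans hud))
  · -- `u` even
    exact nagell_not_isNegFundamentalDiscr_of_two_dvd (h2.trans hGu)
  · -- `3 ∣ u` and `3 ∣ 4u + 27`, so `9 ∣ d`
    have h3u : 3 ∣ u := h3.trans hGu
    have h3v : 3 ∣ 4 * u + 27 := Nat.dvd_add (h3u.mul_left 4) ⟨9, rfl⟩
    exact nagell_not_isNegFundamentalDiscr_of_odd_prime_sq_dvd Nat.prime_three (by decide)
      (Nat.mul_dvd_mul (h3u.mul_right _) h3v)

end Summit.QuantumAdvantage.QuantumAdvantage.Theorems.IqThreeNotPPoly
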